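import Literature.AnabelianGeometry.SemiGraphs.FiniteEtaleCoveringDictionary
import Literature.AnabelianGeometry.SemiGraphs.SubdivisionLemmas
import Literature.AnabelianGeometry.SemiGraphs.SemiGraphLocal
import Literature.AnabelianGeometry.SemiGraphs.ProperBranchLifting
import HarnessLib

/-!
# Connected components of the preimage of a sub-semi-graph ([SemiAnbd] §2, Cor. 2.7 (i) p. 30)

Mochizuki, *Semi-graphs of anabelioids*, Publ. RIMS **42** (2006) 221–322, §2, proof of
Corollary 2.7 (i), p. 30: for a finite étale covering `𝒢′ → 𝒢` "whose restriction to `ℍ` … we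
denote by `ℋ′ → ℍ`", one works with "a connected component `ℋ″` of `ℋ′`"
[cite: MochizukiSemiAnbd2006, Cor. 2.7(i) p.30].  The dictionary fact (D3)
`covering_subgraphComponents_doubleCosets` (abc-iut-L3-d3, `FiniteEtaleCoveringDictionary.lean`)
quantifies over `Hom.IsPreimageComponent φ ℍ K` — connected sub-semi-graphs `K` of `𝔾′` which are
graphs, map into `ℍ`, contain a vertex, and are MAXIMAL among connected sub-semi-graphs mapping
into `ℍ`.

PROOF-ONLY (abc-iut cell, L3 row «D3 discharge», abc-iut-L6-t17; brick M1, valid for ANY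
morphism of semi-graphs of anabelioids over a PROPER base morphism, no covering hypothesis):

* `Subgraph.subdivision_adj_of_adj_map_ι` — adjacency of the barycentric subdivision LIFTS from `𝔾`
  to a sub-semi-graph `L ⊆ 𝔾` for nodes of `L` (with `subdivision_adj_map L.ι`: adjacency in `L` is
  adjacency in `𝔾`);
* `Hom.IsPreimageComponent.reachable_of_mem` — a preimage component is contained in the
  reachability class, inside `φ⁻¹(ℍ)`, of each of its vertices;
* `Hom.IsPreimageComponent.eq_of_mem` — two preimage components with a common vertex coincide;
* `Hom.exists_isPreimageComponent_mem` — over a PROPER base morphism and a sub-GRAPH `ℍ`, every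
  vertex of `𝔾′` over `ℍ` lies in a (unique) preimage component: the reachability class of the
  vertex inside `φ⁻¹(ℍ)` — this is clause (P2) of (D3).
-/

namespace Literature.AnabelianGeometry.SemiGraphs

open CategoryTheory

universe v₁ u₁ u

namespace SemiGraph

variable {G : SemiGraph.{u}}

/-! ### Adjacency of the subdivision lifts to sub-semi-graphs -/

/-- The incidence relation of `𝔾` between (the images of) two nodes of a sub-semi-graph `L` is an
incidence of `L` (conditions (b),(c) of p. 12: the coincidence maps of `L` are the restrictions).
[cite: MochizukiSemiAnbd2006, §1 p.12] -/
theorem Subgraph.nodeRel_of_nodeRel_map_ι (L : G.Subgraph) (x y : L.toSemiGraph.Node)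
    (h : G.NodeRel (Sum.map L.ι.vertexMap (Sum.map L.ι.edgeMap L.ι.branchMap) x)
      (Sum.map L.ι.vertexMap (Sum.map L.ι.edgeMap L.ι.branchMap) y)) :
    L.toSemiGraph.NodeRel x y := by
  rw [nodeRel_iff] at h
  rcases h with ⟨b, hx, hy⟩ | ⟨b, v, hbv, hx, hy⟩
  · rcases x with xv | xe | xb
    · simp at hx
    · rcases y with yv | ye | yb
      · simp at hy
      · simp at hy
      · simp only [Sum.map_inr, Sum.map_inl, Sum.inr.injEq, Sum.inl.injEq] at hx hy
        have hxe : xe = L.toSemiGraph.edgeOf yb := Subtype.ext (hx.trans (congrArg G.edgeOf hy.symm))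
        rw [hxe]
        exact NodeRel.edge_branch yb
    · simp at hx
  · rcases x with xv | xe | xb
    · simp at hx
    · simp at hx
    · rcases y with yv | ye | yb
      · simp only [Sum.map_inr, Sum.map_inl, Sum.inr.injEq, Sum.inl.injEq] at hx hy
        refine NodeRel.branch_vertex xb yv ((Subgraph.abuts_eq_some_iff L xb yv).mpr ?_)
        have hx' : xb.1 = b := hx
        have hy' : yv.1 = v := hy
        rw [hx', hy']
        exact hbv
      · simp at hy
      · simp at hy

/-- **Adjacency lifts.** Two nodes of a sub-semi-graph `L ⊆ 𝔾` which are adjacent in the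
barycentric subdivision of `𝔾` are adjacent in that of `L`. [cite: MochizukiSemiAnbd2006, §1 p.12] -/
theorem Subgraph.subdivision_adj_of_adj_map_ι (L : G.Subgraph) (x y : L.toSemiGraph.Node)
    (h : G.subdivision.Adj (Sum.map L.ι.vertexMap (Sum.map L.ι.edgeMap L.ι.branchMap) x)
      (Sum.map L.ι.vertexMap (Sum.map L.ι.edgeMap L.ι.branchMap) y)) :
    L.toSemiGraph.subdivision.Adj x y := by
  rw [subdivision_adj_iff] at h ⊢
  rcases h with h | h
  · exact Or.inl (L.nodeRel_of_nodeRel_map_ι x y h)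
  · exact Or.inr (L.nodeRel_of_nodeRel_map_ι y x h)

/-- Transfer of adjacency between two sub-semi-graphs `K ⊆ L` of `𝔾` along the inclusion of
nodes. [cite: MochizukiSemiAnbd2006, §1 p.12] -/
theorem Subgraph.subdivision_adj_inclusion {K L : G.Subgraph} (hV : K.verts ⊆ L.verts)
    (hE : K.edges ⊆ L.edges) {x y : K.toSemiGraph.Node} (h : K.toSemiGraph.subdivision.Adj x y) :
    L.toSemiGraph.subdivision.Adj
      (Sum.map (fun v => (⟨v.1, hV v.2⟩ : L.toSemiGraph.Vertex))
        (Sum.map (fun e => (⟨e.1, hE e.2⟩ : L.toSemiGraph.Edge))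
          (fun b => (⟨b.1, hE b.2⟩ : L.toSemiGraph.Branch))) x)
      (Sum.map (fun v => (⟨v.1, hV v.2⟩ : L.toSemiGraph.Vertex))
        (Sum.map (fun e => (⟨e.1, hE e.2⟩ : L.toSemiGraph.Edge))
          (fun b => (⟨b.1, hE b.2⟩ : L.toSemiGraph.Branch))) y) := by
  apply L.subdivision_adj_of_adj_map_ι
  have h' := subdivision_adj_map K.ι h
  rcases x with xv | xe | xb <;> rcases y with yv | ye | yb <;> exact h'

end SemiGraph

namespace SemiGraphOfAnabelioids

open SemiGraph

variable {𝒢 𝒢' : SemiGraphOfAnabelioids.{v₁, u₁, u}}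

/-! ### A preimage component is the reachability class of each of its vertices -/

/-- **Containment in the reachability class.** If `K` is a connected sub-semi-graph of `𝔾′` mapping
into `ℍ` and `w ∈ K`, then every vertex (resp. edge) of `K` is joined to `w` by a walk of the
barycentric subdivision of the full preimage `φ⁻¹(ℍ)`. [cite: MochizukiSemiAnbd2006, Cor. 2.7(i) p.30] -/
theorem reachable_preimage_of_connected (φ : Hom 𝒢' 𝒢) (H : 𝒢.graph.Subgraph)
    (K : 𝒢'.graph.Subgraph) (hK : K.toSemiGraph.IsConnected)
    (hKV : K.verts ⊆ φ.base.vertexMap ⁻¹' H.verts) (hKE : K.edges ⊆ φ.base.edgeMap ⁻¹' H.edges)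
    {w : 𝒢'.graph.Vertex} (hw : w ∈ K.verts) :
    (∀ {u : 𝒢'.graph.Vertex} (hu : u ∈ K.verts),
      (⟨φ.base.vertexMap ⁻¹' H.verts, φ.base.edgeMap ⁻¹' H.edges⟩ : 𝒢'.graph.Subgraph)
        |>.toSemiGraph.subdivision.Reachable (Sum.inl ⟨w, hKV hw⟩) (Sum.inl ⟨u, hKV hu⟩)) ∧
    ∀ {e : 𝒢'.graph.Edge} (he : e ∈ K.edges),
      (⟨φ.base.vertexMap ⁻¹' H.verts, φ.base.edgeMap ⁻¹' H.edges⟩ : 𝒢'.graph.Subgraph)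
        |>.toSemiGraph.subdivision.Reachable (Sum.inl ⟨w, hKV hw⟩) (Sum.inr (Sum.inl ⟨e, hKE he⟩)) := by
  -- the inclusion of `K` in the preimage, as a homomorphism of the subdivisions
  let D : 𝒢'.graph.Subgraph := ⟨φ.base.vertexMap ⁻¹' H.verts, φ.base.edgeMap ⁻¹' H.edges⟩
  let f : K.toSemiGraph.subdivision →g D.toSemiGraph.subdivision :=
    { toFun := Sum.map (fun v => (⟨v.1, hKV v.2⟩ : D.toSemiGraph.Vertex))
        (Sum.map (fun e => (⟨e.1, hKE e.2⟩ : D.toSemiGraph.Edge))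
          (fun b => (⟨b.1, hKE b.2⟩ : D.toSemiGraph.Branch)))
      map_rel' := fun h => Subgraph.subdivision_adj_inclusion hKV hKE h }
  constructor
  · intro u hu
    exact (hK.connected.preconnected (Sum.inl ⟨w, hw⟩) (Sum.inl ⟨u, hu⟩)).map f
  · intro e he
    exact (hK.connected.preconnected (Sum.inl ⟨w, hw⟩) (Sum.inr (Sum.inl ⟨e, he⟩))).map f

/-- A preimage component `K ∋ w` is contained in the reachability class of `w` inside `φ⁻¹(ℍ)`:
vertices. [cite: MochizukiSemiAnbd2006, Cor. 2.7(i) p.30] -/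
theorem Hom.IsPreimageComponent.reachable_of_mem {φ : Hom 𝒢' 𝒢} {H : 𝒢.graph.Subgraph}
    {K : 𝒢'.graph.Subgraph} (hK : φ.IsPreimageComponent H K) {w u : 𝒢'.graph.Vertex}
    (hw : w ∈ K.verts) (hu : u ∈ K.verts) :
    (⟨φ.base.vertexMap ⁻¹' H.verts, φ.base.edgeMap ⁻¹' H.edges⟩ : 𝒢'.graph.Subgraph)
      |>.toSemiGraph.subdivision.Reachable (Sum.inl ⟨w, hK.2.2.2.1 hw⟩) (Sum.inl ⟨u, hK.2.2.2.1 hu⟩) :=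
  (reachable_preimage_of_connected φ H K hK.1 hK.2.2.2.1 hK.2.2.2.2.1 hw).1 hu

/-! ### The reachability class of a vertex over `ℍ` -/

section Class

variable (φ : Hom 𝒢' 𝒢) (H : 𝒢.graph.Subgraph) (v' : 𝒢'.graph.Vertex)

/-- The reachability class of `v′` inside `φ⁻¹(ℍ)` maps into `ℍ`, contains `v′`, and is CONNECTED
(walks of the preimage from `v′` stay inside the class and lift to its own subdivision).
[cite: MochizukiSemiAnbd2006, Cor. 2.7(i) p.30] -/
theorem isConnected_reachClass (hv : φ.base.vertexMap v' ∈ H.verts) :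
    (⟨{u | ∃ hu : φ.base.vertexMap u ∈ H.verts,
        (⟨φ.base.vertexMap ⁻¹' H.verts, φ.base.edgeMap ⁻¹' H.edges⟩ : 𝒢'.graph.Subgraph)
          |>.toSemiGraph.subdivision.Reachable (Sum.inl ⟨v', hv⟩) (Sum.inl ⟨u, hu⟩)},
      {e | ∃ he : φ.base.edgeMap e ∈ H.edges,
        (⟨φ.base.vertexMap ⁻¹' H.verts, φ.base.edgeMap ⁻¹' H.edges⟩ : 𝒢'.graph.Subgraph)
          |>.toSemiGraph.subdivision.Reachable (Sum.inl ⟨v', hv⟩) (Sum.inr (Sum.inl ⟨e, he⟩))}⟩ :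
      𝒢'.graph.Subgraph).toSemiGraph.IsConnected := by
  classical
  -- notation
  let D : 𝒢'.graph.Subgraph := ⟨φ.base.vertexMap ⁻¹' H.verts, φ.base.edgeMap ⁻¹' H.edges⟩
  let n₀ : D.toSemiGraph.Node := Sum.inl ⟨v', hv⟩
  let R : D.toSemiGraph.Node → Prop := fun n => D.toSemiGraph.subdivision.Reachable n₀ n
  let K : 𝒢'.graph.Subgraph :=
    ⟨{u | ∃ hu : φ.base.vertexMap u ∈ H.verts, R (Sum.inl ⟨u, hu⟩)},
      {e | ∃ he : φ.base.edgeMap e ∈ H.edges, R (Sum.inr (Sum.inl ⟨e, he⟩))}⟩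
  change K.toSemiGraph.IsConnected
  -- a branch node of `D` which is reachable has a reachable edge node
  have hRbr : ∀ (b : D.toSemiGraph.Branch), R (Sum.inr (Sum.inr b)) →
      R (Sum.inr (Sum.inl (D.toSemiGraph.edgeOf b))) := fun b hb =>
    hb.trans (D.toSemiGraph.subdivision_reachable_edge_branch b).symm
  -- lifting a reachable node of `D` to a node of `K`
  let lift : ∀ n : D.toSemiGraph.Node, R n → K.toSemiGraph.Node := fun n =>
    match n with
    | Sum.inl u => fun h => Sum.inl ⟨u.1, u.2, h⟩
    | Sum.inr (Sum.inl e) => fun h => Sum.inr (Sum.inl ⟨e.1, e.2, h⟩)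
    | Sum.inr (Sum.inr b) => fun h => Sum.inr (Sum.inr ⟨b.1, (D.toSemiGraph.edgeOf b).2, hRbr b h⟩)
  have hlift_val : ∀ (n : D.toSemiGraph.Node) (h : R n),
      Sum.map K.ι.vertexMap (Sum.map K.ι.edgeMap K.ι.branchMap) (lift n h) =
        Sum.map D.ι.vertexMap (Sum.map D.ι.edgeMap D.ι.branchMap) n := by
    rintro (u | e | b) h <;> rfl
  -- adjacency in `D` between reachable nodes lifts to `K`
  have hadj : ∀ (a b : D.toSemiGraph.Node) (ha : R a) (hb : R b),
      D.toSemiGraph.subdivision.Adj a b → K.toSemiGraph.subdivision.Adj (lift a ha) (lift b hb) := by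
    intro a b ha hb h
    apply K.subdivision_adj_of_adj_map_ι
    rw [hlift_val, hlift_val]
    exact subdivision_adj_map D.ι h
  -- walks of `D` from a reachable node lift to walks of `K`
  have hwalk : ∀ (a t : D.toSemiGraph.Node) (p : D.toSemiGraph.subdivision.Walk a t) (ha : R a)
      (ht : R t), K.toSemiGraph.subdivision.Reachable (lift a ha) (lift t ht) := by
    intro a t p
    induction p with
    | nil => intro ha ht; exact SimpleGraph.Reachable.refl _
    | @cons a c t hac p ih =>
      intro ha ht
      have hc : R c := ha.trans hac.reachable
      exact (hadj a c ha hc hac).reachable.trans (ih hc ht)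
  have hR₀ : R n₀ := SimpleGraph.Reachable.refl _
  -- every node of `K` is the lift of a reachable node of `D`
  have hsurj : ∀ x : K.toSemiGraph.Node, ∃ (t : D.toSemiGraph.Node) (ht : R t), lift t ht = x := by
    rintro (u | e | b)
    · exact ⟨Sum.inl ⟨u.1, u.2.1⟩, u.2.2, rfl⟩
    · exact ⟨Sum.inr (Sum.inl ⟨e.1, e.2.1⟩), e.2.2, rfl⟩
    · obtain ⟨he, hRe⟩ := b.2
      exact ⟨Sum.inr (Sum.inr ⟨b.1, he⟩),
        hRe.trans (D.toSemiGraph.subdivision_reachable_edge_branch ⟨b.1, he⟩), rfl⟩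
  have hreach : ∀ x : K.toSemiGraph.Node, K.toSemiGraph.subdivision.Reachable (lift n₀ hR₀) x := by
    intro x
    obtain ⟨t, ht, rfl⟩ := hsurj x
    exact ht.elim fun p => hwalk n₀ t p hR₀ ht
  refine ⟨?_⟩
  rw [SimpleGraph.connected_iff]
  exact ⟨fun x y => (hreach x).symm.trans (hreach y), ⟨lift n₀ hR₀⟩⟩

/-- Over a PROPER base morphism and a sub-GRAPH `ℍ` (every branch of an edge of `ℍ` abuts to a
vertex of `ℍ`), the reachability class of `v′` inside `φ⁻¹(ℍ)` is a GRAPH: a branch of one of its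
edges abuts (properness lifts the abutment from `ℍ`), to a vertex over `ℍ` adjacent to the edge,
hence in the class. [cite: MochizukiSemiAnbd2006, Cor. 2.7(i) p.30] -/
theorem isGraph_reachClass (hv : φ.base.vertexMap v' ∈ H.verts) (hprop : SemiGraph.IsProper φ.base)
    (hHg : H.toSemiGraph.IsGraph) :
    (⟨{u | ∃ hu : φ.base.vertexMap u ∈ H.verts,
        (⟨φ.base.vertexMap ⁻¹' H.verts, φ.base.edgeMap ⁻¹' H.edges⟩ : 𝒢'.graph.Subgraph)
          |>.toSemiGraph.subdivision.Reachable (Sum.inl ⟨v', hv⟩) (Sum.inl ⟨u, hu⟩)},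
      {e | ∃ he : φ.base.edgeMap e ∈ H.edges,
        (⟨φ.base.vertexMap ⁻¹' H.verts, φ.base.edgeMap ⁻¹' H.edges⟩ : 𝒢'.graph.Subgraph)
          |>.toSemiGraph.subdivision.Reachable (Sum.inl ⟨v', hv⟩) (Sum.inr (Sum.inl ⟨e, he⟩))}⟩ :
      𝒢'.graph.Subgraph).toSemiGraph.IsGraph := by
  classical
  let D : 𝒢'.graph.Subgraph := ⟨φ.base.vertexMap ⁻¹' H.verts, φ.base.edgeMap ⁻¹' H.edges⟩
  let n₀ : D.toSemiGraph.Node := Sum.inl ⟨v', hv⟩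
  refine ⟨fun b => ?_⟩
  obtain ⟨he, hRe⟩ := b.2
  -- the image branch abuts (ℍ is a graph), hence so does `b` (properness)
  have hb₀ : (H.toSemiGraph.abuts ⟨φ.base.branchMap b.1, by
      rw [φ.base.edgeOf_branchMap]; exact he⟩).isSome := hHg.abuts_isSome _
  obtain ⟨x, hx⟩ := Option.isSome_iff_exists.mp hb₀
  have hx' : 𝒢.graph.abuts (φ.base.branchMap b.1) = some x.1 :=
    (Subgraph.abuts_eq_some_iff H _ x).mp hx
  have hbv : φ.base.branchMap b.1 ∈ 𝒢.graph.verticialPortion (φ.base.edgeMap (𝒢'.graph.edgeOf b.1)) :=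
    ⟨φ.base.edgeOf_branchMap b.1, by rw [hx']; rfl⟩
  obtain ⟨⟨b₂, hb₂⟩, hb₂b⟩ :=
    (SemiGraph.branchMap_verticialPortion_bijective φ.base hprop (𝒢'.graph.edgeOf b.1)).2
      ⟨φ.base.branchMap b.1, hbv⟩
  have hbb : b₂ = b.1 :=
    φ.base.branchMap_injOn _ _ hb₂.1 (congrArg Subtype.val hb₂b)
  obtain ⟨u, hu⟩ := Option.isSome_iff_exists.mp (hbb ▸ hb₂.2)
  -- `u` lies over `ℍ` and is adjacent to the (reachable) edge of `b`, so `u` is in the class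
  have hφu : φ.base.vertexMap u ∈ H.verts := by
    have h1 := φ.base.abuts_branchMap b.1 u hu
    rw [hx'] at h1
    rw [← Option.some.inj h1]
    exact x.2
  have hRu : D.toSemiGraph.subdivision.Reachable n₀ (Sum.inl ⟨u, hφu⟩) :=
    (hRe.trans (D.toSemiGraph.subdivision_reachable_edge_branch ⟨b.1, he⟩)).trans
      (D.toSemiGraph.subdivision_reachable_branch_vertex
        ((Subgraph.abuts_eq_some_iff D ⟨b.1, he⟩ ⟨u, hφu⟩).mpr hu))
  rw [Option.isSome_iff_exists]
  exact ⟨⟨u, hφu, hRu⟩, (Subgraph.abuts_eq_some_iff _ b ⟨u, hφu, hRu⟩).mpr hu⟩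

/-- **(P2) of the dictionary fact (D3): existence (and uniqueness) of the component through a
vertex.** Over a PROPER base morphism and a connected? — no: any — sub-GRAPH `ℍ`, every vertex `v′`
of `𝔾′` over `ℍ` lies in a preimage component, namely its reachability class inside `φ⁻¹(ℍ)`.
[cite: MochizukiSemiAnbd2006, Cor. 2.7(i) p.30] -/
theorem Hom.exists_isPreimageComponent_mem (hv : φ.base.vertexMap v' ∈ H.verts)
    (hprop : SemiGraph.IsProper φ.base) (hHg : H.toSemiGraph.IsGraph) :
    ∃ K : 𝒢'.graph.Subgraph, φ.IsPreimageComponent H K ∧ v' ∈ K.verts := by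
  classical
  let D : 𝒢'.graph.Subgraph := ⟨φ.base.vertexMap ⁻¹' H.verts, φ.base.edgeMap ⁻¹' H.edges⟩
  let n₀ : D.toSemiGraph.Node := Sum.inl ⟨v', hv⟩
  let K : 𝒢'.graph.Subgraph :=
    ⟨{u | ∃ hu : φ.base.vertexMap u ∈ H.verts,
        D.toSemiGraph.subdivision.Reachable n₀ (Sum.inl ⟨u, hu⟩)},
      {e | ∃ he : φ.base.edgeMap e ∈ H.edges,
        D.toSemiGraph.subdivision.Reachable n₀ (Sum.inr (Sum.inl ⟨e, he⟩))}⟩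
  have hKV : K.verts ⊆ φ.base.vertexMap ⁻¹' H.verts := fun u hu => hu.1
  have hKE : K.edges ⊆ φ.base.edgeMap ⁻¹' H.edges := fun e he => he.1
  have hv'K : v' ∈ K.verts := ⟨hv, SimpleGraph.Reachable.refl _⟩
  refine ⟨K, ⟨isConnected_reachClass φ H v' hv, isGraph_reachClass φ H v' hv hprop hHg, ⟨v', hv'K⟩,
    hKV, hKE, fun K' hK' hK'V hK'E hVle hEle => ?_⟩, hv'K⟩
  -- maximality: a connected `K' ⊇ K` mapping into `ℍ` lies inside the class of `v′`
  have hsub := reachable_preimage_of_connected φ H K' hK' hK'V hK'E (hVle hv'K)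
  ext u
  · exact ⟨fun hu => ⟨hK'V hu, hsub.1 hu⟩, fun hu => hVle hu⟩
  · exact ⟨fun he => ⟨hK'E he, hsub.2 he⟩, fun he => hEle he⟩

/-- **Uniqueness: preimage components with a common vertex coincide** (each is the reachability
class of the common vertex, by maximality). [cite: MochizukiSemiAnbd2006, Cor. 2.7(i) p.30] -/
theorem Hom.IsPreimageComponent.eq_of_mem {φ : Hom 𝒢' 𝒢} {H : 𝒢.graph.Subgraph}
    {K₁ K₂ : 𝒢'.graph.Subgraph} (h₁ : φ.IsPreimageComponent H K₁) (h₂ : φ.IsPreimageComponent H K₂)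
    {w : 𝒢'.graph.Vertex} (hw₁ : w ∈ K₁.verts) (hw₂ : w ∈ K₂.verts) : K₁ = K₂ := by
  classical
  let D : 𝒢'.graph.Subgraph := ⟨φ.base.vertexMap ⁻¹' H.verts, φ.base.edgeMap ⁻¹' H.edges⟩
  have hw : φ.base.vertexMap w ∈ H.verts := h₁.2.2.2.1 hw₁
  let n₀ : D.toSemiGraph.Node := Sum.inl ⟨w, hw⟩
  let K : 𝒢'.graph.Subgraph :=
    ⟨{u | ∃ hu : φ.base.vertexMap u ∈ H.verts,
        D.toSemiGraph.subdivision.Reachable n₀ (Sum.inl ⟨u, hu⟩)},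
      {e | ∃ he : φ.base.edgeMap e ∈ H.edges,
        D.toSemiGraph.subdivision.Reachable n₀ (Sum.inr (Sum.inl ⟨e, he⟩))}⟩
  have hKconn : K.toSemiGraph.IsConnected := isConnected_reachClass φ H w hw
  have hKV : K.verts ⊆ φ.base.vertexMap ⁻¹' H.verts := fun u hu => hu.1
  have hKE : K.edges ⊆ φ.base.edgeMap ⁻¹' H.edges := fun e he => he.1
  -- both components are contained in the class `K`, hence equal to it by maximality
  have key : ∀ {K₀ : 𝒢'.graph.Subgraph}, φ.IsPreimageComponent H K₀ → w ∈ K₀.verts → K₀ = K := by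
    intro K₀ h₀ hw₀
    have hsub := reachable_preimage_of_connected φ H K₀ h₀.1 h₀.2.2.2.1 h₀.2.2.2.2.1 hw₀
    exact (h₀.2.2.2.2.2 K hKconn hKV hKE (fun u hu => ⟨h₀.2.2.2.1 hu, hsub.1 hu⟩)
      (fun e he => ⟨h₀.2.2.2.2.1 he, hsub.2 he⟩)).symm
  rw [key h₁ hw₁, key h₂ hw₂]

end Class

end SemiGraphOfAnabelioids

end Literature.AnabelianGeometry.SemiGraphs
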